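import Summits.QuantumFields.BalabanUV.Beta.D1BFx.GhostLegProfile
import Summits.QuantumFields.BalabanUV.Beta.D1BFx.ProjectorSupNorm
import Summits.QuantumFields.BalabanUV.Beta.D1BFx.ProfileWordCount

/-!
# `BalabanUV.Beta.D1BFx.GhostLegProfilesRight` — road «BF-x» for binder row D1, slot (K), GHOST-N8-SPEC v0.2 §3″ FILE F3 (instance half, PART 1):
# **THE TWO ELEMENTARY GHOST LEGS IN THE PROFILE CURRENCY** — β2's `Ggh` profile (value exponent `2`, right∕left differences exponent `3`, all `≲ n⁻²`,
# scales `n = L^k`) and `ProjectorSupNorm`'s `Pgt` (flat: value `≲ n⁻⁴`, differences `≲ n⁻⁵`) restated VERBATIM in the one shape FILE F1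
# (`GhostVertexOrientation.abs_comp_gW_le`) and gaps-g1-p1's `ProfileLegComposition` consume: `κ ∕ nrm (x − y) ^ a * exp (−(δ∕n) * supNorm (x − y))`
# with `nrm`, `supNorm` of `PoissonInterior`, at ANY weaker rate `δ′ ≤ δ`

HONEST DEPENDENCY (cell records, verbatim): «continuum YM on T⁴ ⇐ BetaPertH ∧ nine spine estimates (0/9 proved); BetaPertH ⇐ (D1) ∧ (D4) ∧
CAP+tail; G-an2-4 gates asym, D1 and NE2/3/4.»  HONEST FRAMING (cell contract, verbatim): «discharging `BetaPertH` makes Bałaban's UV stability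
UNCONDITIONAL — a real constructive-QFT result; it is NOT the continuum limit and NOT the Clay problem.»  THIS MODULE DISCHARGES NOTHING of the
wall: [folklore] change of norm dialect BY NAME over gan24-leaf-05's β2 `GhostLegProfile.exists_Ggh_profile` (the scalar ghost leg's pointwise profile,
itself lit-balaban's `B3GkZeroLatticePointwise` read through `Ggh_eq_GkLat`) and leaf-11's `ProjectorSupNorm.abs_Pgt_le_sup ∕ abs_Pgt_diff(_right)_le_sup`
(Bałaban's gauge-term projector at `U = 1`, `≲ n⁻⁴`, smooth at scale `n`), with leaf-05's `RJetProjector.dist_le_side_mul_dist_blk` for the block →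
fine distance.  No definition, no `def … : Prop`, nothing cited, 0 sorry.  0 root-level binders of row D1 discharged (hW ∕ hR-sockets ∕ hSX-socket ∕
D1Tel ∕ D1Rep = 0); (K) NOT closed; NOT D1, NOT `BetaPertH`, NOT continuum, NOT Clay.

ABSOLUTE RULE (cell charter, verbatim): «No internally-minted statement may enter as a cited fact. Every hypothesis is either kernel-proved in
this package or a verbatim quotation of a PUBLISHED theorem with page reference. The manuscript(s) under audit are NOT citable for their own
disputed steps — they are the thing under adjudication; programme-internal (2001/route/tribunal) claims are never citable.»

WHY (GHOST-N8-SPEC v0.2 §3″ (O5), journal N-1 [D1LEAF04-G26-N1], INTENT-4).  The per-word ghost rows (F5) price every leg by a VALUE profile and a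
RIGHT-DIFFERENCE profile (F1 §3's `hL`∕`hdL`); the composites `P∘G`, `G∘P`, `G∘(P∘G)`, `G∘G` are gaps-g1-p1's `ProfileLegComposition` applied to the
two elementary legs.  Three sup-norm dialects meet here (`B3CxiUniformBound.supNorm` in β2, the sup METRIC of `Fin 4 → ℤ` on block labels in
`ProjectorSupNorm`, `PoissonInterior.supNorm`∕`nrm` in (d1)∕F1∕F2∕gaps); this file is the one place they are reconciled.

CONTENT ([folklore]; `Site 4 = Fin 4 → ℤ`, fibre `Unit`).
* §0 dialect bridges: `supNorm3_eq` (β2's `ℕ`-sup-norm IS `PoissonInterior.supNorm`, `rfl`), `e_eq_unitVec` (`rfl`), `dist_eq_cast_supNorm` (the sup metric),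
  `exp_blk_le` (`e^{−δ·dist(blk x, blk y)} ≤ e^{δ}·e^{−(δ∕n)‖x−y‖∞}`, blocks of side `n`), `exp_rate_mono`.
* §1 **`ggh_profiles`**: from β2, `∃ δ C, 0 < δ ∧ 0 < C ∧ ∀ k ≥ 1, ∀ n, n = L^k → ∀ δ′ ∈ [0, δ]`: VALUE `|Ggh n a x y| ≤ (C∕n²)∕nrm(x−y)^2·e^{−(δ′∕n)‖x−y‖∞}`,
  LEFT and RIGHT unit differences `≤ (C∕n²)∕nrm(x−y)^3·e^{−(δ′∕n)‖x−y‖∞}` — F1's `hL`∕`hdL` shapes (`a = 2`, `a′ = 3`).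
* §2 **`abs_Pgt_le_profile`**, **`abs_Pgt_diff_right_le_profile`**, **`abs_Pgt_diff_left_le_profile`** (`n ≥ 1`, `0 < a`, any `0 ≤ δ′ ≤ δ_PP(4,a)`):
  `|Pgt n a x y| ≤ (cPPs 4 a·e^{δ_PP}∕n⁴)∕nrm(x−y)^0·e^{−(δ′∕n)‖x−y‖∞}`, differences with `n⁵` — F1's shapes (`a = a′ = 0`) and gaps' FLAT shape.
NOT HERE (honest): the composites (PART 2, over gaps-g1-p1's `Gaps/ProfileLegComposition`), the rows (F5); anything at the END's weights.
Unit `b2b-balaban-beta-d1-formalise-leaf-04` (gen 26), D1 formalisation swarm, road «BF-x»; INTENT-4 [D1LEAF04-G26-INTENT-4]. Not in print; no existing file touched.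
-/

noncomputable section

namespace Summit.QuantumFields.BalabanUV.Beta.D1BFx.GhostLegProfilesRight

open scoped BigOperators
open Finset
open Literature.MathematicalPhysics.QuantumFieldTheory.Balaban1983to89
open Literature.MathematicalPhysics.QuantumFieldTheory.Balaban1983to89.Beta
open ExpKernelCalculus (Site MKer)
open AffineAveraging (unitVec)
open B6QGQLower276 (X e blk)
open PoissonInterior (supNorm nrm nrm_pos one_le_nrm supNorm_neg natAbs_le_supNorm exists_natAbs_eq_supNorm)
open Summit.QuantumFields.BalabanUV.Beta.D1BFx.GhostLeg (Ggh cast_pred_add_one)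
open Summit.QuantumFields.BalabanUV.Beta.D1BFx.GhostLegProfile (exists_Ggh_profile)
open Summit.QuantumFields.BalabanUV.Beta.D1BFx.RProjector (Pgt deltaPP deltaPP_pos)
open Summit.QuantumFields.BalabanUV.Beta.D1BFx.ProjectorSupNorm (cPPs cPPs_nonneg abs_Pgt_le_sup abs_Pgt_diff_le_sup abs_Pgt_diff_right_le_sup)
open Summit.QuantumFields.BalabanUV.Beta.D1BFx.RJetProjector (dist_le_side_mul_dist_blk)

/-! ## §0 Dialect bridges -/

/-- [folklore] β2's `ℕ`-valued sup norm (`B3CxiUniformBound.supNorm`) IS `PoissonInterior.supNorm` on `ℤ⁴`. -/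
theorem supNorm3_eq (u : Site 4) : B3CxiUniformBound.supNorm (d := 4) u = supNorm u := rfl

/-- [folklore] The unit vector of `B6QGQLower276` IS `AffineAveraging.unitVec`. -/
theorem e_eq_unitVec (μ : Fin 4) : (e μ : X 4) = unitVec μ := rfl

/-- [folklore] The sup metric of `Fin 4 → ℤ` is the sup norm of the difference. -/
theorem dist_eq_cast_supNorm (x y : Site 4) : dist x y = (supNorm (x - y) : ℝ) := by
  apply le_antisymm
  · refine (dist_pi_le_iff (by positivity)).2 fun i => ?_
    rw [Int.dist_eq]
    have h : (((x - y) i).natAbs : ℝ) ≤ (supNorm (x - y) : ℝ) := by exact_mod_cast natAbs_le_supNorm (x - y) i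
    have e1 : (((x - y) i).natAbs : ℝ) = |((x i : ℝ) - (y i : ℝ))| := by
      rw [Nat.cast_natAbs, Int.cast_abs, Pi.sub_apply, Int.cast_sub]
    linarith [e1 ▸ h]
  · obtain ⟨i, hi⟩ := exists_natAbs_eq_supNorm (by norm_num : 0 < 4) (x - y)
    have h := dist_le_pi_dist x y i
    rw [Int.dist_eq] at h
    have e1 : (((x - y) i).natAbs : ℝ) = |((x i : ℝ) - (y i : ℝ))| := by
      rw [Nat.cast_natAbs, Int.cast_abs, Pi.sub_apply, Int.cast_sub]
    rw [← hi, e1]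
    exact h

/-- [folklore] **BLOCK DISTANCE DOMINATES FINE DISTANCE AT SCALE `n`**: for blocks of side `n` (`blk (n−1)`), `0 ≤ δ′ ≤ δ`,
`e^{−δ·dist(blk x, blk y)} ≤ e^{δ}·e^{−(δ′∕n)‖x − y‖∞}`. -/
theorem exp_blk_le (n : ℕ) [NeZero n] {δ δ' : ℝ} (hδ' : 0 ≤ δ') (hle : δ' ≤ δ) (x y : Site 4) :
    Real.exp (-(δ * dist (blk (n - 1) x) (blk (n - 1) y))) ≤ Real.exp δ * Real.exp (-(δ' / n) * supNorm (x - y)) := by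
  have hn : (0 : ℝ) < (n : ℝ) := by exact_mod_cast Nat.pos_of_ne_zero (NeZero.ne n)
  have hδ : 0 ≤ δ := hδ'.trans hle
  have h2 := dist_le_side_mul_dist_blk (n - 1) x y
  rw [cast_pred_add_one n, dist_eq_cast_supNorm] at h2
  rw [← Real.exp_add]
  apply Real.exp_le_exp.2
  have hs : (0 : ℝ) ≤ supNorm (x - y) := Nat.cast_nonneg _
  have hD0 : 0 ≤ dist (blk (n - 1) x) (blk (n - 1) y) := dist_nonneg
  -- `(δ′∕n)·s ≤ (δ∕n)·s ≤ δ·dist_blk + δ·(n−1)∕n ≤ δ·dist_blk + δ`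
  have h3 : δ' / n * (supNorm (x - y) : ℝ) ≤ δ / n * (supNorm (x - y) : ℝ) :=
    mul_le_mul_of_nonneg_right (div_le_div_of_nonneg_right hle hn.le) hs
  have h4 : δ / n * (supNorm (x - y) : ℝ) ≤ δ * dist (blk (n - 1) x) (blk (n - 1) y) + δ := by
    have hpred : ((n - 1 : ℕ) : ℝ) ≤ (n : ℝ) := by exact_mod_cast Nat.sub_le n 1
    have : δ / n * (supNorm (x - y) : ℝ) ≤ δ / n * ((n : ℝ) * dist (blk (n - 1) x) (blk (n - 1) y) + ((n - 1 : ℕ) : ℝ)) :=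
      mul_le_mul_of_nonneg_left h2 (div_nonneg hδ hn.le)
    refine this.trans ?_
    rw [mul_add, ← mul_assoc, div_mul_cancel₀ δ hn.ne']
    have : δ / n * ((n - 1 : ℕ) : ℝ) ≤ δ := by
      rw [div_mul_eq_mul_div, div_le_iff₀ hn]; nlinarith
    linarith
  linarith

/-- [folklore] Rate monotonicity of a profile: `0 ≤ δ′ ≤ δ` ⟹ `e^{−(δ∕n)s} ≤ e^{−(δ′∕n)s}` for `s ≥ 0`, `n ≥ 1`. -/
theorem exp_rate_mono {n : ℕ} (hn : 1 ≤ n) {δ δ' : ℝ} (hle : δ' ≤ δ) (z : Site 4) :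
    Real.exp (-(δ / n) * supNorm z) ≤ Real.exp (-(δ' / n) * supNorm z) := by
  have hn0 : (0 : ℝ) < n := by exact_mod_cast hn
  apply Real.exp_le_exp.2
  have hs : (0 : ℝ) ≤ supNorm z := Nat.cast_nonneg _
  have := mul_le_mul_of_nonneg_right (div_le_div_of_nonneg_right hle hn0.le) hs
  linarith

/-! ## §1 The scalar ghost leg `Ggh` (β2) in the profile currency -/

section Ghost

variable {L : ℕ} (hL : 2 ≤ L) {a : ℝ} (ha : 0 < a)
include hL ha

/-- [folklore] **β2 IN THE PROFILE CURRENCY, ANY WEAKER RATE**: there are `δ > 0`, `C > 0` (of `L`, `a`) such that for every `k ≥ 1`, `n = L^k`, every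
`0 ≤ δ′ ≤ δ`: `|Ggh n a x y| ≤ (C∕n²)∕nrm(x−y)^2·e^{−(δ′∕n)‖x−y‖∞}` and both unit differences `≤ (C∕n²)∕nrm(x−y)^3·e^{−(δ′∕n)‖x−y‖∞}` — the shapes
`hL` (`a = 2`), `hdL` (`a′ = 3`) of F1 `GhostVertexOrientation.abs_comp_gW_le` ∕ `abs_gW_comp_le` and of gaps-g1-p1's `ProfileLegComposition`. -/
theorem ggh_profiles : ∃ δ C : ℝ, 0 < δ ∧ 0 < C ∧ ∀ (k : ℕ), 1 ≤ k → ∀ (n : ℕ) [NeZero n], n = L ^ k →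
    ∀ δ' : ℝ, 0 ≤ δ' → δ' ≤ δ →
      (∀ x y : Site 4, |Ggh n a x y () ()| ≤ (C / (n : ℝ) ^ 2) / nrm (x - y) ^ 2 * Real.exp (-(δ' / n) * supNorm (x - y))) ∧
      (∀ (x y : Site 4) (μ : Fin 4), |Ggh n a (x + unitVec μ) y () () - Ggh n a x y () ()|
          ≤ (C / (n : ℝ) ^ 2) / nrm (x - y) ^ 3 * Real.exp (-(δ' / n) * supNorm (x - y))) ∧
      (∀ (x y : Site 4) (μ : Fin 4), |Ggh n a x (y + unitVec μ) () () - Ggh n a x y () ()|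
          ≤ (C / (n : ℝ) ^ 2) / nrm (x - y) ^ 3 * Real.exp (-(δ' / n) * supNorm (x - y))) := by
  obtain ⟨δ, C, hδ, hC, h⟩ := exists_Ggh_profile hL ha
  refine ⟨δ, C, hδ, hC, fun k hk n _ hnk δ' hδ'0 hδ'le => ?_⟩
  have hn1 : 1 ≤ n := by
    rw [hnk]; exact Nat.one_le_pow _ _ (by omega)
  have hn0 : (0 : ℝ) < n := by exact_mod_cast hn1
  -- the common conversion of one β2 clause with exponent `p`
  have conv : ∀ (p : ℕ) (z : Site 4) (t : ℝ),
      t ≤ C * ((n : ℝ) ^ 2)⁻¹ * ((max 1 ((B3CxiUniformBound.supNorm (d := 4) z : ℕ) : ℝ)) ^ p)⁻¹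
            * Real.exp (-(δ * (B3CxiUniformBound.supNorm (d := 4) z : ℕ) / n)) →
      t ≤ (C / (n : ℝ) ^ 2) / nrm z ^ p * Real.exp (-(δ' / n) * supNorm z) := by
    intro p z t ht
    rw [supNorm3_eq] at ht
    refine ht.trans ?_
    have hq := nrm_pos z
    have e1 : C * ((n : ℝ) ^ 2)⁻¹ * ((max 1 (supNorm z : ℝ)) ^ p)⁻¹ = (C / (n : ℝ) ^ 2) / nrm z ^ p := by
      unfold PoissonInterior.nrm; field_simp
    have e2 : Real.exp (-(δ * (supNorm z : ℕ) / n)) = Real.exp (-(δ / n) * supNorm z) := by congr 1; ring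
    rw [e1, e2]
    exact mul_le_mul_of_nonneg_left (exp_rate_mono hn1 hδ'le z) (by positivity)
  refine ⟨fun x y => ?_, fun x y μ => ?_, fun x y μ => ?_⟩
  · exact conv 2 (x - y) _ (h k hk n hnk x y () ()).1
  · have h2 := (h k hk n hnk x y () ()).2.1 μ
    rw [e_eq_unitVec] at h2
    exact conv 3 (x - y) _ h2
  · have h3 := (h k hk n hnk x y () ()).2.2 μ
    rw [e_eq_unitVec] at h3
    exact conv 3 (x - y) _ h3

end Ghost

/-! ## §2 The gauge-term projector `Pgt` in the profile currency (flat) -/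

section Projector

variable (n : ℕ) [NeZero n] {a : ℝ} (ha : 0 < a) {δ' : ℝ} (hδ'0 : 0 ≤ δ') (hδ'le : δ' ≤ deltaPP 4 a)
include ha hδ'0 hδ'le

/-- [folklore] **`Pgt` IS A FLAT PROFILE LEG**: `|Pgt n a x y| ≤ (cPPs 4 a·e^{δ_PP}∕n⁴)∕nrm(x−y)^0·e^{−(δ′∕n)‖x−y‖∞}` for any `0 ≤ δ′ ≤ δ_PP(4,a)`. -/
theorem abs_Pgt_le_profile (x y : Site 4) (u v : Unit) :
    |Pgt n a x y u v| ≤ (cPPs 4 a * Real.exp (deltaPP 4 a) / (n : ℝ) ^ 4) / nrm (x - y) ^ 0 * Real.exp (-(δ' / n) * supNorm (x - y)) := by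
  have hn : (0 : ℝ) < (n : ℝ) := by exact_mod_cast Nat.pos_of_ne_zero (NeZero.ne n)
  refine (abs_Pgt_le_sup n ha x y u v).trans ?_
  have hb := exp_blk_le n hδ'0 hδ'le x y
  have hc : 0 ≤ cPPs 4 a / (n : ℝ) ^ 4 := div_nonneg (cPPs_nonneg 4 ha) (pow_pos hn 4).le
  calc cPPs 4 a / (n : ℝ) ^ 4 * Real.exp (-(deltaPP 4 a * dist (blk (n - 1) x) (blk (n - 1) y)))
      ≤ cPPs 4 a / (n : ℝ) ^ 4 * (Real.exp (deltaPP 4 a) * Real.exp (-(δ' / n) * supNorm (x - y))) := mul_le_mul_of_nonneg_left hb hc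
    _ = _ := by rw [pow_zero, div_one]; ring

/-- [folklore] **`Pgt`'s RIGHT DIFFERENCE IS A SMALLER FLAT LEG**: `|Pgt n a x (y+e_μ) − Pgt n a x y| ≤ (cPPs 4 a·e^{δ_PP}∕n⁵)∕nrm(x−y)^0·e^{−(δ′∕n)‖x−y‖∞}`. -/
theorem abs_Pgt_diff_right_le_profile (x y : Site 4) (μ : Fin 4) (u v : Unit) :
    |Pgt n a x (y + unitVec μ) u v - Pgt n a x y u v|
      ≤ (cPPs 4 a * Real.exp (deltaPP 4 a) / (n : ℝ) ^ 5) / nrm (x - y) ^ 0 * Real.exp (-(δ' / n) * supNorm (x - y)) := by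
  have hn : (0 : ℝ) < (n : ℝ) := by exact_mod_cast Nat.pos_of_ne_zero (NeZero.ne n)
  have h := abs_Pgt_diff_right_le_sup n ha x y μ u v
  rw [e_eq_unitVec] at h
  refine h.trans ?_
  have hb := exp_blk_le n hδ'0 hδ'le x y
  have hc : 0 ≤ cPPs 4 a / (n : ℝ) ^ 5 := div_nonneg (cPPs_nonneg 4 ha) (pow_pos hn 5).le
  calc cPPs 4 a / (n : ℝ) ^ 5 * Real.exp (-(deltaPP 4 a * dist (blk (n - 1) x) (blk (n - 1) y)))
      ≤ cPPs 4 a / (n : ℝ) ^ 5 * (Real.exp (deltaPP 4 a) * Real.exp (-(δ' / n) * supNorm (x - y))) := mul_le_mul_of_nonneg_left hb hc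
    _ = _ := by rw [pow_zero, div_one]; ring

/-- [folklore] **`Pgt`'s LEFT DIFFERENCE**: `|Pgt n a (x+e_μ) y − Pgt n a x y| ≤ (cPPs 4 a·e^{δ_PP}∕n⁵)∕nrm(x−y)^0·e^{−(δ′∕n)‖x−y‖∞}`. -/
theorem abs_Pgt_diff_left_le_profile (x y : Site 4) (μ : Fin 4) (u v : Unit) :
    |Pgt n a (x + unitVec μ) y u v - Pgt n a x y u v|
      ≤ (cPPs 4 a * Real.exp (deltaPP 4 a) / (n : ℝ) ^ 5) / nrm (x - y) ^ 0 * Real.exp (-(δ' / n) * supNorm (x - y)) := by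
  have hn : (0 : ℝ) < (n : ℝ) := by exact_mod_cast Nat.pos_of_ne_zero (NeZero.ne n)
  have h := abs_Pgt_diff_le_sup n ha x y μ u v
  rw [e_eq_unitVec] at h
  refine h.trans ?_
  have hb := exp_blk_le n hδ'0 hδ'le x y
  have hc : 0 ≤ cPPs 4 a / (n : ℝ) ^ 5 := div_nonneg (cPPs_nonneg 4 ha) (pow_pos hn 5).le
  calc cPPs 4 a / (n : ℝ) ^ 5 * Real.exp (-(deltaPP 4 a * dist (blk (n - 1) x) (blk (n - 1) y)))
      ≤ cPPs 4 a / (n : ℝ) ^ 5 * (Real.exp (deltaPP 4 a) * Real.exp (-(δ' / n) * supNorm (x - y))) := mul_le_mul_of_nonneg_left hb hc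
    _ = _ := by rw [pow_zero, div_one]; ring

end Projector

end Summit.QuantumFields.BalabanUV.Beta.D1BFx.GhostLegProfilesRight

end
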